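import Summits.Ventures.ResidMod.RowVerdicts
import Literature.NumberTheory.DiophantineGeometry.Bcgp2025ModThreeListedImageModular
import HarnessLib

/-!
# Venture ResidMod — census-row verdict for the flag T-S (mod-3 image one of the 15 listed classes,
# BCGP 2025 Thm. 9.5.2): local slots from Euler factors, image slots and `End(A_ℚ̄) = ℤ` as binders

HONEST FRAMING. Interface file of a COMPUTATION cell (`pub-residmod`). NO surface is claimed modular;
nothing is computed here; the cited theorems are hypotheses (named facts of the tree, NOT proved there):
`hList` = `bcgp2025_modThreeListedImage_modular_abelianSurface` (BCGP 2025 Thm. 9.5.2 with Lemma 6.4.3 /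
Table 6.4.4, typed by the cell's LIT-1 seat), `hDel` (Deligne 1969 / Howe 1995 ordinarity criterion),
`hNOS` (Serre–Tate 1968 Thm. 1). Compared with the surjective row (`modular_of_mod3RowNOS`) the
residual-image slot is richer and stays ENTIRELY a binder (the cell's offline certificate for an EXACT
image in the printed list): the torsion frame of `ρb`, the `J`-symplecticity with `GSp₄`-reasonableness
and tidiness, absolute irreducibility of `ρ̄(G_{ℚ(ζ₃)})`, the two regular-semisimple witnesses, and
`End(A_ℚ̄) = ℤ` (TYP — for these images NOT automatic; in the cell an LMFDB datum unless L-TYP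
certifies it). The LOCAL slots are derived in the kernel from the Euler factors at `2` and `3` exactly as
for T-L: F2OK and UNRAM2 from `L₂`, GOOD(3) via `hNOS`, ORD(3) via `hDel` (`3 ∤ b₃`), (3b) from the
separability of `L₃(T)` (a Bézout identity per row).

* `modular_of_mod3ListedRowNOS` — conclusion: every framed dual of every `V_p(A)` is `IsAutomorphicAE`.

References: [BoxerCalegariGeePilloni2025] arXiv:2502.20645 Thm. 9.5.2, Lemma 6.4.3, Table 6.4.4,
Lemma 9.1.3, Def. 9.1.2; [Whitmore2022] Def. 3.19; [SerreTate1968] §1 Thm. 1; [Deligne1969OrdinaryAV] §2.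
-/

noncomputable section

namespace Summit.Ventures.ResidMod

open Equiv CategoryTheory IsDedekindDomain Field Polynomial Matrix
open scoped NumberField
open Literature.NumberTheory.GaloisRepresentations Literature.NumberTheory.Automorphic
open Literature.NumberTheory.Automorphic.Paramodular
open Literature.NumberTheory.DiophantineGeometry Literature.NumberTheory.FaltingsSerre
open Literature.AlgebraicGeometry.Motives (AbelianVariety HasGoodReductionAt)

/-- **T-S census row (listed mod-3 image), final form.**  Binders: the torsion frame (`ρb`, `hframe`),
the image slots `himg` (symplectic for `J` with multiplier `ε̄⁻¹`, `GSp₄`-reasonable, tidy), `habs`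
(absolute irreducibility over `ℚ(ζ₃)`), `hrs₁`, `hrs₂` (regular semisimple witnesses), `hEnd`
(`End(A_ℚ̄) = ℤ`); Euler factors at `2` (`¬(b₂ ≡ 2 ∧ a₂ ≢ 0 mod 3)`) and `3` (`3 ∤ b₃`, `L₃(T)`
separable); named facts `hList`, `hDel`, `hNOS`. Kernel-derived: F2OK, UNRAM2, GOOD(3), ORD(3), (3b).
CONDITIONAL on the three facts; every datum a binder. [cite: BoxerCalegariGeePilloni2025, Thm. 9.5.2, Lemma 6.4.3, Def. 9.1.2] [cite: SerreTate1968, §1 Thm. 1] -/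
theorem modular_of_mod3ListedRowNOS (hList : bcgp2025_modThreeListedImage_modular_abelianSurface)
    (hDel : deligne_hasGoodOrdinaryReductionAt_iff_not_dvd_middleCoeff)
    (A : AbelianVariety ℚ) (hA : A.dim = 2)
    (hNOS : ∀ v : HeightOneSpectrum (𝓞 ℚ), A.hasGoodReductionAt_of_isUnramifiedAt v)
    (ρb : FramedGaloisRep ℚ (ZMod 3) 4)
    (hframe : ∃ e₃ : A.geomTorsion (3 : ℕ) ≃+ (Fin 4 → ZMod 3),
      ∀ (g : absoluteGaloisGroup ℚ) (P : A.geomTorsion (3 : ℕ)),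
        e₃ (g • P) = ((ρb g⁻¹ : GL (Fin 4) (ZMod 3)) : Matrix (Fin 4) (Fin 4) (ZMod 3))ᵀ *ᵥ e₃ P)
    (himg : ∃ J : Matrix (Fin 4) (Fin 4) (ZMod 3), Jᵀ = -J ∧ IsUnit J.det ∧
      (∀ σ : absoluteGaloisGroup ℚ,
        (ρb σ).valᵀ * J * (ρb σ).val =
          (((modPCyclotomicCharacterZMod ℚ 3 σ)⁻¹ : (ZMod 3)ˣ) : ZMod 3) • J) ∧
      ρb.IsGSp4Reasonable J 3 ∧ ρb.IsTidy J)
    (habs : IsAbsIrreducible (ρb.imageOn (galCyclotomicPow ℚ 3 1)).subtype)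
    (hrs₁ : ∃ g ∈ ρb.imageOn (galCyclotomicPow ℚ 3 1), IsRegularSemisimple g)
    (hrs₂ : ∃ g ∈ ρb.imageOn ⊤, g ∉ ρb.imageOn (galCyclotomicPow ℚ 3 1) ∧ IsRegularSemisimple g)
    (hEnd : ∀ f : A.baseChange (AlgebraicClosure ℚ) ⟶ A.baseChange (AlgebraicClosure ℚ),
      ∃ n : ℤ, f = n • 𝟙 (A.baseChange (AlgebraicClosure ℚ)))
    {a₂ b₂ : ℤ} (hL2 : A.HasGoodEulerFactorAt 2 ((lPolynomialOfSurface 2 a₂ b₂).map (Int.castRingHom ℚ)))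
    (hab : ¬ (((b₂ : ℤ) : ZMod 3) = 2 ∧ ((a₂ : ℤ) : ZMod 3) ≠ 0))
    {a₃ b₃ : ℤ} (hL3 : A.HasGoodEulerFactorAt 3 ((lPolynomialOfSurface 3 a₃ b₃).map (Int.castRingHom ℚ)))
    (hb₃ : ¬ (3 : ℤ) ∣ b₃) (hsepL : ((lPolynomialOfSurface 3 a₃ b₃).map (Int.castRingHom ℚ)).Separable) :
    ∀ (p : ℕ) [Fact p.Prime] (b : Module.Basis (Fin 4) ℚ_[p] (A.rationalTateModule p))
      (r : FramedGaloisRep ℚ (PadicAlgCl p) 4),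
      (∀ g : absoluteGaloisGroup ℚ,
        (r g).val =
          ((LinearMap.toMatrix b b (A.rationalTateRep p g⁻¹)).map
            (algebraMap ℚ_[p] (PadicAlgCl p))).transpose) →
      ∀ (hcpt : isCompact_glFiniteIntegralLevel 4 ℚ) (ι : PadicAlgCl p ≃+* ℂ),
        IsAutomorphicAE ι hcpt r := by
  haveI : Fact (Nat.Prime 3) := ⟨Nat.prime_three⟩
  intro p _ b r hr hcpt ι
  obtain ⟨e₃, he₃⟩ := hframe
  have hframe' : ∀ (σ : absoluteGaloisGroup ℚ) (P : A.geomTorsion (3 : ℕ)),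
      e₃ (σ • P) = ((FramedRep.dual ρb σ : GL (Fin 4) (ZMod 3)) :
        Matrix (Fin 4) (Fin 4) (ZMod 3)) *ᵥ e₃ P := by
    intro σ P
    rw [he₃, FramedRep.coe_dual_apply, map_inv]
  have hgood₃ := hasGoodReductionAt_of_hasGoodEulerFactorAt hA hNOS Nat.prime_three hL3
  exact hList A hA (FramedRep.dual ρb) e₃ ρb hframe' (FramedRep.dual_dual ρb) himg habs hrs₁ hrs₂ hEnd
    (fun v hv => ⟨torsionRep_isUnramifiedAt_of_hasGoodEulerFactorAt hA hL2 (ℓ := 3) (by decide) ρb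
        ⟨e₃, he₃⟩ v hv, frobCharpoly_two_ne_of_eulerData hA ⟨e₃, he₃⟩ hL2 hab v hv⟩)
    (fun v hv => hasGoodOrdinaryReductionAt_of_not_dvd_middleCoeff hDel hA hL3 hb₃ hv (hgood₃ v hv))
    (fun ℓ _ hℓ b' r' hr' v hv =>
      separable_dualFrame_of_hasGoodEulerFactorAt hL3
        (coeff_zero_lPolynomialOfSurface_map_ne_zero 3 _ _) hsepL ℓ hℓ b' r' hr' v hv)
    p b r hr hcpt ι

end Summit.Ventures.ResidMod

end
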